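import Literature.NumberTheory.Sieve.HeathBrownCubicPrimes
import Literature.NumberTheory.Sieve.HeathBrownCubicPrimesHolds
import Literature.NumberTheory.Sieve.CircleMethod
import Literature.NumberTheory.Sieve.CircleMethodTernaryProofs
import Literature.NumberTheory.Sieve.CircleMethodMajorArcsProofs
import Literature.NumberTheory.Sieve.VinogradovExpSum
import Literature.NumberTheory.LFunctions.SiegelWalfisz
import Mathlib.NumberTheory.DiophantineApproximation.Basic
import Literature.NumberTheory.Sieve.SieveFramework
import Literature.NumberTheory.Sieve.PolynomialValuesSieveBounds
import Literature.NumberTheory.Sieve.VinogradovExpSumTools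
import Literature.NumberTheory.Sieve.BombieriFriedlanderIwaniecTheorem5Poisson
import Literature.NumberTheory.LFunctions.MertensElementary
import Mathlib.NumberTheory.PrimeCounting
import Mathlib.NumberTheory.Chebyshev
import Mathlib.Analysis.SpecialFunctions.Pow.Asymptotics
import Mathlib.MeasureTheory.Integral.IntervalIntegral.Basic
import Mathlib.MeasureTheory.Integral.IntervalIntegral.Periodic
import Literature.NumberTheory.Sieve.RamanujanSum
import Literature.NumberTheory.Sieve.DivisorPowerSums
import Mathlib.MeasureTheory.Integral.Bochner.Basic
import Mathlib.MeasureTheory.Function.LocallyIntegrable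
import Mathlib.Analysis.SpecialFunctions.Pow.Real
import Literature.NumberTheory.Sieve.CubicMinorantDefs
import Literature.NumberTheory.Waring.HuaLemmaCubes
import HarnessLib
import Literature.NumberTheory.Sieve.TernaryHolderCounting
import Literature.NumberTheory.Sieve.RoughModelPairCount
import Literature.NumberTheory.Sieve.RoughModelFourierApprox
import Literature.NumberTheory.Sieve.HeathBrownWeightFourthMoment
import Literature.NumberTheory.LFunctions.ZetaPowCoeffShortInterval
import Summits.Parity.GeneralizedHardyLittlewood.Theses.VinogradovHeathBrown

/-! # VinogradovHeathBrown (1/3) — A3, the read-out: `readout_holds : Readout` (item stmt-Parity-19777 of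
`route-Parity-VinogradovHeathBrown`)

Ledger of record: tier A, ledger **FRONTIER**; no bearing on prime pairs / parity / GHL (tribunal J 2026-08-26).
If the odd `N` has NO representation `p + q + (x³ + 2y³)` of the target shape, every non-zero term of
`T(Λ_N, Λ_N, f₃)` has a higher prime power in the first or second slot, so
`T(Λ_N, Λ_N, f₃) ≤ C″ N^{3/2} (log N)^4` (Chebyshev bounds of Mathlib; `∑ f₃ ≤` Heath-Brown pair count, `mass_le`).
Also the elementary weight facts used by all three blocks (`vmWeight_*`, `sum_hbWeight_le`, `mass_le`,
`exists_of_hbRep_ne_zero`). Sources: [HeathBrownActa2001] (Theorem 1), [Nathanson1996] (§8.1), [Vaughan1997] (§3.1).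

Theorems-side PORT of the cell evidence `pub/parity-ideate/parity-ideate-p2/evidence/LineEFG_tree.lean`
(KERNEL-PROVED there, farm rc 0, axioms std), re-namespaced into the route namespace (precedent
`Theorems/MaynardProductExactGlue.lean`) and re-based on the LANDED Literature modules `CubicMinorantDefs`
(p407241: the weights `vmWeight`, `gWeight`, `hbWeight`, `apWeight`, `ternarySum`, `expSumOf`),
`TernaryHolderCounting` (E5, p410251), `RoughModelPairCount` (E6, p410680), `RoughModelFourierApprox`
(E2, p410505), `HeathBrownWeightFourthMoment` (E4b, p410644), whose public lemmas replace the evidence's local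
copies. Notation: `T = ternarySum`, `Λ_N = vmWeight N`, `g_B = gWeight B N` (the `W`-rough model of level
`(log N)^B` on `[1, N]`), `f₃ = hbWeight c N` (Heath-Brown primes `x³+2y³` from the box
`X < x, y ≤ X(1+η)`, `X = (N/6)^{1/3}`, `η = (log X)^{-c}`, weight `N^{1/3} log`). Port prepared and
farm-checked by parity-ideate-p2 g5 (planner); filed by a prover seat. -/

noncomputable section

open scoped FourierTransform ArithmeticFunction
open Finset MeasureTheory Filter

namespace Summit.Parity.GeneralizedHardyLittlewood.Theses.VinogradovHeathBrown

open Literature.NumberTheory.Sieve Literature.NumberTheory.Sieve.CubicPrimes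
open Literature.NumberTheory.Sieve.CubicMinorant hiding RoughModelFourierApprox HBFourierFourthMoment
  roughModelFourierApprox_holds hbFourierFourthMoment_holds
open Literature.NumberTheory.Waring.HuaCubes
-- `log` is monotone on ℕ: the landed lemma (dedup.landed) replaces the evidence's local copy
open Literature.NumberTheory.LFunctions.SelbergDelange.DivisorBounds (log_natCast_mono)

section ReadoutProof

open scoped Chebyshev
open ArithmeticFunction

/-- Each coordinate of a tuple in `antidiagonalTuple k N` is `≤ N`. [folklore] -/
theorem apply_le_of_mem_antidiagonalTuple' {k N : ℕ} {n : Fin k → ℕ}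
    (hn : n ∈ Finset.Nat.antidiagonalTuple k N) (i : Fin k) : n i ≤ N := by
  rw [Finset.Nat.mem_antidiagonalTuple] at hn
  rw [← hn]
  exact Finset.single_le_sum (fun j _ => Nat.zero_le (n j)) (Finset.mem_univ i)

/-- `Λ_N ≥ 0` (the von Mangoldt weight cut off at `N`). [folklore] -/
theorem vmWeight_nonneg (N m : ℕ) : 0 ≤ vmWeight N m := by
  unfold vmWeight; split_ifs; exacts [vonMangoldt_nonneg, le_rfl]

/-- `Λ_N(m) ≤ Λ(m)`. [folklore] -/
theorem vmWeight_le_vonMangoldt (N m : ℕ) : vmWeight N m ≤ Λ m := by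
  unfold vmWeight; split_ifs; exacts [le_rfl, vonMangoldt_nonneg]

/-- `Λ_N(m) ≤ log N` for `m ≤ N`. [folklore] -/
theorem vmWeight_le_log {N m : ℕ} (h : m ≤ N) : vmWeight N m ≤ Real.log N :=
  (vmWeight_le_vonMangoldt N m).trans (vonMangoldt_le_log.trans (log_natCast_mono h))

/-- What a Heath-Brown pair gives: `x, y ≥ 1`, `x³ + 2y³` prime, `= n` and `> N/2`. [this line] -/
theorem exists_of_hbRep_ne_zero {c : ℝ} {N n : ℕ} (h : hbRep c N n ≠ 0) :
    ∃ x y : ℕ, 0 < x ∧ 0 < y ∧ (x ^ 3 + 2 * y ^ 3).Prime ∧ x ^ 3 + 2 * y ^ 3 = n ∧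
      N < 2 * n := by
  obtain ⟨⟨x, y⟩, hxy⟩ := Finset.card_ne_zero.1 h
  rw [mem_filter] at hxy
  obtain ⟨hmem, hval⟩ := hxy
  simp only at hval
  rw [mem_primePairs_iff] at hmem
  obtain ⟨hXx, -, hXy, -, -, hprime⟩ := hmem
  have hX0 : 0 ≤ hbX N := hbX_nonneg N
  have hx0 : (0 : ℝ) < x := hX0.trans_lt hXx
  have hy0 : (0 : ℝ) < y := hX0.trans_lt hXy
  refine ⟨x, y, by exact_mod_cast hx0, by exact_mod_cast hy0, hprime, hval, ?_⟩
  have hx3 : hbX N ^ 3 < (x : ℝ) ^ 3 := by gcongr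
  have hy3 : hbX N ^ 3 < (y : ℝ) ^ 3 := by gcongr
  rw [hbX_pow_three] at hx3 hy3
  have : (N : ℝ) < 2 * n := by
    rw [← hval]; push_cast; linarith
  exact_mod_cast this

/-- The swap `n ↦ n ∘ (0 1)` identifies the triples with `n₁` non-prime and those with `n₀`
non-prime, for a sum symmetric in the first two weights. [folklore] -/
theorem sum_filter_not_prime_one_eq (f f₃ : ℕ → ℝ) (N : ℕ) :
    ∑ n ∈ (Finset.Nat.antidiagonalTuple 3 N).filter (fun n => ¬ (n 1).Prime),
        f (n 0) * f (n 1) * f₃ (n 2) =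
      ∑ n ∈ (Finset.Nat.antidiagonalTuple 3 N).filter (fun n => ¬ (n 0).Prime),
        f (n 0) * f (n 1) * f₃ (n 2) := by
  refine Finset.sum_equiv ((Equiv.swap (0 : Fin 3) 1).arrowCongr (Equiv.refl ℕ)) (fun n => ?_)
    (fun n _ => ?_)
  · simp only [Finset.mem_filter, Finset.Nat.mem_antidiagonalTuple, Equiv.arrowCongr_apply,
      Equiv.coe_refl, Equiv.symm_swap, Function.comp_apply, id_eq, Equiv.swap_apply_left]
    rw [Equiv.sum_comp (Equiv.swap (0 : Fin 3) 1) n]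
  · simp only [Equiv.arrowCongr_apply, Equiv.coe_refl, Equiv.symm_swap, Function.comp_apply, id_eq,
      Equiv.swap_apply_left, Equiv.swap_apply_right]
    rw [Equiv.swap_apply_of_ne_of_ne (show (2 : Fin 3) ≠ 0 by decide)
      (show (2 : Fin 3) ≠ 1 by decide)]
    ring

/-- Triples with `n₀` non-prime contribute `≤ (ψ(N) − ϑ(N)) · log N · ∑_{m ≤ N} f₃(m)`: bound
`Λ'(n₁) ≤ log N` and inject `n ↦ (n₀, n₂)` into `{m ≤ N non-prime} × {m ≤ N}` (tree pattern:
`ParityWave0TernaryGoldbachProofs`, §7.4 of Helfgott). [folklore] -/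
theorem sum_filter_not_prime_zero_le' (N : ℕ) {f₃ : ℕ → ℝ} (hf₃ : ∀ m, 0 ≤ f₃ m) :
    ∑ n ∈ (Finset.Nat.antidiagonalTuple 3 N).filter (fun n => ¬ (n 0).Prime),
        vmWeight N (n 0) * vmWeight N (n 1) * f₃ (n 2) ≤
      (ψ N - θ N) * Real.log N * ∑ m ∈ range (N + 1), f₃ m := by
  set S := (Finset.Nat.antidiagonalTuple 3 N).filter (fun n => ¬ (n 0).Prime) with hS
  have hA : ∑ a ∈ (Icc 0 N).filter (fun a => ¬ a.Prime), Λ a = ψ N - θ N := by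
    rw [Chebyshev.psi_sub_theta_eq_sum_not_prime, Nat.floor_natCast, Finset.sum_filter,
      Finset.sum_filter, ← Finset.add_sum_Ioc_eq_sum_Icc (Nat.zero_le N)]
    simp
  have hL : 0 ≤ Real.log N := Real.log_natCast_nonneg N
  have h1 : ∀ n ∈ S, vmWeight N (n 0) * vmWeight N (n 1) * f₃ (n 2) ≤
      Λ (n 0) * Real.log N * f₃ (n 2) := by
    intro n hn
    have hT := (Finset.mem_filter.mp hn).1
    exact mul_le_mul_of_nonneg_right
      (mul_le_mul (vmWeight_le_vonMangoldt N _)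
        (vmWeight_le_log (apply_le_of_mem_antidiagonalTuple' hT 1)) (vmWeight_nonneg N _)
        vonMangoldt_nonneg) (hf₃ _)
  have hinj : Set.InjOn (fun n : Fin 3 → ℕ => (n 0, n 2)) ↑S := by
    intro n hn n' hn' h
    simp only [hS, Finset.coe_filter, Set.mem_setOf_eq, Finset.Nat.mem_antidiagonalTuple,
      Fin.sum_univ_three] at hn hn'
    simp only [Prod.mk.injEq] at h
    funext j
    fin_cases j
    · exact h.1
    · simp only [Fin.reduceFinMk]
      omega
    · exact h.2
  have hsub : S.image (fun n : Fin 3 → ℕ => (n 0, n 2)) ⊆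
      (Icc 0 N).filter (fun a => ¬ a.Prime) ×ˢ range (N + 1) := by
    intro ab hab
    obtain ⟨n, hn, rfl⟩ := Finset.mem_image.mp hab
    have hT := (Finset.mem_filter.mp hn).1
    simp only [Finset.mem_product, Finset.mem_filter, Finset.mem_Icc, Nat.zero_le, true_and,
      Finset.mem_range]
    exact ⟨⟨apply_le_of_mem_antidiagonalTuple' hT 0, (Finset.mem_filter.mp hn).2⟩,
      Nat.lt_succ_of_le (apply_le_of_mem_antidiagonalTuple' hT 2)⟩
  calc ∑ n ∈ S, vmWeight N (n 0) * vmWeight N (n 1) * f₃ (n 2)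
      ≤ ∑ n ∈ S, Λ (n 0) * Real.log N * f₃ (n 2) := Finset.sum_le_sum h1
    _ = ∑ ab ∈ S.image (fun n : Fin 3 → ℕ => (n 0, n 2)), Λ ab.1 * Real.log N * f₃ ab.2 :=
        (Finset.sum_image (f := fun ab : ℕ × ℕ => Λ ab.1 * Real.log N * f₃ ab.2) hinj).symm
    _ ≤ ∑ ab ∈ (Icc 0 N).filter (fun a => ¬ a.Prime) ×ˢ range (N + 1),
          Λ ab.1 * Real.log N * f₃ ab.2 :=
        Finset.sum_le_sum_of_subset_of_nonneg hsub fun ab _ _ =>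
          mul_nonneg (mul_nonneg vonMangoldt_nonneg hL) (hf₃ _)
    _ = (∑ a ∈ (Icc 0 N).filter (fun a => ¬ a.Prime), Λ a) * Real.log N *
          ∑ m ∈ range (N + 1), f₃ m := by
        rw [Finset.sum_product, Finset.sum_mul, Finset.sum_mul]
        refine Finset.sum_congr rfl fun a _ => ?_
        rw [Finset.mul_sum]
    _ = (ψ N - θ N) * Real.log N * ∑ m ∈ range (N + 1), f₃ m := by rw [hA]

/-- The mass of `f₃`: `∑_{m ≤ N} f₃(m) ≤ N^{1/3} log N · π(𝒜)(X, η)`. [this line] -/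
theorem sum_hbWeight_le (c : ℝ) (N : ℕ) :
    ∑ m ∈ range (N + 1), hbWeight c N m ≤
      (N : ℝ) ^ ((1 : ℝ) / 3) * Real.log N * primePairCount (hbX N) (hbEta c N) := by
  calc ∑ m ∈ range (N + 1), hbWeight c N m
      ≤ ∑ m ∈ range (N + 1), (N : ℝ) ^ ((1 : ℝ) / 3) * Real.log N * (hbRep c N m : ℝ) := by
        refine Finset.sum_le_sum fun m hm => ?_
        unfold hbWeight
        exact mul_le_mul_of_nonneg_right
          (mul_le_mul_of_nonneg_left (log_natCast_mono (Nat.lt_succ_iff.1 (mem_range.1 hm)))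
            (by positivity)) (Nat.cast_nonneg _)
    _ = (N : ℝ) ^ ((1 : ℝ) / 3) * Real.log N * ∑ m ∈ range (N + 1), (hbRep c N m : ℝ) := by
        rw [Finset.mul_sum]
    _ ≤ (N : ℝ) ^ ((1 : ℝ) / 3) * Real.log N * primePairCount (hbX N) (hbEta c N) := by
        refine mul_le_mul_of_nonneg_left ?_
          (mul_nonneg (by positivity) (Real.log_natCast_nonneg N))
        have h : ∑ m ∈ range (N + 1), hbRep c N m ≤ primePairCount (hbX N) (hbEta c N) := by
          unfold hbRep
          rw [primePairCount_def, Finset.sum_card_fiberwise_eq_card_filter]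
          exact Finset.card_filter_le _ _
        exact_mod_cast h

/-- `π(𝒜)(X, η) ≤ (⌊X(1+η)⌋ + 1)²` (the bounding box). [folklore] -/
theorem primePairCount_le_sq (X η : ℝ) :
    (primePairCount X η : ℝ) ≤ ((⌊X * (1 + η)⌋₊ : ℝ) + 1) ^ 2 := by
  have h : primePairCount X η ≤ (⌊X * (1 + η)⌋₊ + 1) ^ 2 := by
    rw [primePairCount_def, primePairs]
    refine (Finset.card_filter_le _ _).trans ?_
    rw [Finset.card_product, Nat.card_Iic, sq]
  exact_mod_cast h

/-- For `N ≥ 126`: `X ≥ e`, so `η ≤ 1` and `N^{1/3} log N · π(𝒜)(X, η) ≤ 9 N log N`. [this line] -/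
theorem mass_le {c : ℝ} (hc : 0 < c) {N : ℕ} (hN : 126 ≤ N) :
    (N : ℝ) ^ ((1 : ℝ) / 3) * Real.log N * primePairCount (hbX N) (hbEta c N) ≤
      9 * N * Real.log N := by
  have hN0 : (0 : ℝ) < N := by exact_mod_cast (show 0 < N by omega)
  have hN' : (126 : ℝ) ≤ N := by exact_mod_cast hN
  have hX0 : 0 ≤ hbX N := hbX_nonneg N
  -- `X ≥ e`
  have hXe : Real.exp 1 ≤ hbX N := by
    by_contra h
    rw [not_le] at h
    have h3 : hbX N ^ 3 < Real.exp 1 ^ 3 := by gcongr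
    rw [hbX_pow_three] at h3
    have he := Real.exp_one_lt_d9
    have he0 := Real.exp_pos 1
    have h21 : Real.exp 1 ^ 3 < 2.7182818286 ^ 3 := by gcongr
    have h21' : (2.7182818286 : ℝ) ^ 3 < 21 := by norm_num
    linarith
  have hX1 : 1 ≤ hbX N := le_trans (by have := Real.add_one_le_exp (1 : ℝ); linarith) hXe
  have hLX : 1 ≤ Real.log (hbX N) := by
    rw [Real.le_log_iff_exp_le (by linarith)]; exact hXe
  have hη : hbEta c N ≤ 1 := Real.rpow_le_one_of_one_le_of_nonpos hLX (by linarith)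
  have hη0 : 0 ≤ hbEta c N := Real.rpow_nonneg (by linarith) _
  -- `π(𝒜) ≤ 9 X²`
  have hPP : (primePairCount (hbX N) (hbEta c N) : ℝ) ≤ 9 * hbX N ^ 2 := by
    refine (primePairCount_le_sq _ _).trans ?_
    have hfl : (⌊hbX N * (1 + hbEta c N)⌋₊ : ℝ) ≤ hbX N * (1 + hbEta c N) :=
      Nat.floor_le (by positivity)
    have h2 : (⌊hbX N * (1 + hbEta c N)⌋₊ : ℝ) + 1 ≤ 3 * hbX N := by nlinarith
    calc ((⌊hbX N * (1 + hbEta c N)⌋₊ : ℝ) + 1) ^ 2 ≤ (3 * hbX N) ^ 2 := by gcongr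
      _ = 9 * hbX N ^ 2 := by ring
  -- `X ≤ N^{1/3}`, so `N^{1/3} X² ≤ N`
  have hXN : hbX N ≤ (N : ℝ) ^ ((1 : ℝ) / 3) := by
    unfold hbX
    exact Real.rpow_le_rpow (by positivity) (by linarith) (by norm_num)
  have hcube : ((N : ℝ) ^ ((1 : ℝ) / 3)) ^ 3 = N := by
    rw [← Real.rpow_natCast, ← Real.rpow_mul hN0.le]; norm_num
  have hNX : (N : ℝ) ^ ((1 : ℝ) / 3) * hbX N ^ 2 ≤ (N : ℝ) := by
    calc (N : ℝ) ^ ((1 : ℝ) / 3) * hbX N ^ 2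
        ≤ (N : ℝ) ^ ((1 : ℝ) / 3) * ((N : ℝ) ^ ((1 : ℝ) / 3)) ^ 2 := by gcongr
      _ = ((N : ℝ) ^ ((1 : ℝ) / 3)) ^ 3 := by ring
      _ = (N : ℝ) := hcube
  have hL0 : 0 ≤ Real.log N := Real.log_natCast_nonneg N
  calc (N : ℝ) ^ ((1 : ℝ) / 3) * Real.log N * primePairCount (hbX N) (hbEta c N)
      ≤ (N : ℝ) ^ ((1 : ℝ) / 3) * Real.log N * (9 * hbX N ^ 2) :=
        mul_le_mul_of_nonneg_left hPP (by positivity)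
    _ = 9 * ((N : ℝ) ^ ((1 : ℝ) / 3) * hbX N ^ 2) * Real.log N := by ring
    _ ≤ 9 * N * Real.log N := by gcongr

/-- **A3 PROVED.** [this line] -/
theorem readout_holds : Readout := by
  intro c hc
  refine ⟨36, 126, fun N hN _hodd hno => ?_⟩
  have hN0 : (0 : ℝ) < N := by exact_mod_cast (show 0 < N by omega)
  have hN1 : (1 : ℝ) ≤ N := by exact_mod_cast (show 1 ≤ N by omega)
  have hL1 : 1 ≤ Real.log N := by
    rw [Real.le_log_iff_exp_le hN0]
    have := Real.exp_one_lt_d9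
    have h3 : (3 : ℝ) ≤ N := by exact_mod_cast (show 3 ≤ N by omega)
    linarith
  have hL0 : 0 ≤ Real.log N := by linarith
  have hFnn : ∀ n : Fin 3 → ℕ, 0 ≤ vmWeight N (n 0) * vmWeight N (n 1) * hbWeight c N (n 2) :=
    fun n => mul_nonneg (mul_nonneg (vmWeight_nonneg _ _) (vmWeight_nonneg _ _))
      (hbWeight_nonneg _ _ _)
  -- Step 1: under the no-representation hypothesis, triples with `n₀, n₁` prime vanish
  have hzero : ∀ n ∈ Finset.Nat.antidiagonalTuple 3 N, (n 0).Prime → (n 1).Prime →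
      vmWeight N (n 0) * vmWeight N (n 1) * hbWeight c N (n 2) = 0 := by
    intro n hn h0 h1
    by_cases hr : hbRep c N (n 2) = 0
    · simp [hbWeight, hr]
    · exfalso
      obtain ⟨x, y, hx, hy, hp, hval, hlt⟩ := exists_of_hbRep_ne_zero hr
      refine hno ⟨n 0, n 1, x, y, hx, hy, h0, h1, hp, ?_, hval ▸ hlt⟩
      rw [hval]
      have := hn
      rw [Finset.Nat.mem_antidiagonalTuple, Fin.sum_univ_three] at this
      exact this
  -- Step 2: split the ternary sum
  have hsplit : ternarySum (vmWeight N) (vmWeight N) (hbWeight c N) N ≤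
      ∑ n ∈ (Finset.Nat.antidiagonalTuple 3 N).filter (fun n => ¬ (n 0).Prime),
          vmWeight N (n 0) * vmWeight N (n 1) * hbWeight c N (n 2) +
        ∑ n ∈ (Finset.Nat.antidiagonalTuple 3 N).filter (fun n => ¬ (n 1).Prime),
          vmWeight N (n 0) * vmWeight N (n 1) * hbWeight c N (n 2) := by
    unfold ternarySum
    rw [← Finset.sum_filter_add_sum_filter_not (Finset.Nat.antidiagonalTuple 3 N)
      (fun n => (n 0).Prime ∧ (n 1).Prime)]
    have h2 : ∑ n ∈ (Finset.Nat.antidiagonalTuple 3 N).filter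
        (fun n => (n 0).Prime ∧ (n 1).Prime),
        vmWeight N (n 0) * vmWeight N (n 1) * hbWeight c N (n 2) = 0 :=
      Finset.sum_eq_zero fun n hn => by
        have h' := Finset.mem_filter.mp hn
        exact hzero n h'.1 h'.2.1 h'.2.2
    rw [h2, zero_add]
    have hsub : (Finset.Nat.antidiagonalTuple 3 N).filter
        (fun n => ¬ ((n 0).Prime ∧ (n 1).Prime)) ⊆
        (Finset.Nat.antidiagonalTuple 3 N).filter (fun n => ¬ (n 0).Prime) ∪
          (Finset.Nat.antidiagonalTuple 3 N).filter (fun n => ¬ (n 1).Prime) := by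
      intro n hn
      rw [Finset.mem_union, Finset.mem_filter, Finset.mem_filter]
      obtain ⟨hn, h⟩ := Finset.mem_filter.mp hn
      by_cases h0 : (n 0).Prime
      · exact Or.inr ⟨hn, fun h1 => h ⟨h0, h1⟩⟩
      · exact Or.inl ⟨hn, h0⟩
    refine (Finset.sum_le_sum_of_subset_of_nonneg hsub fun n _ _ => hFnn n).trans ?_
    have hui := Finset.sum_union_inter
      (s₁ := (Finset.Nat.antidiagonalTuple 3 N).filter (fun n => ¬ (n 0).Prime))
      (s₂ := (Finset.Nat.antidiagonalTuple 3 N).filter (fun n => ¬ (n 1).Prime))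
      (f := fun n => vmWeight N (n 0) * vmWeight N (n 1) * hbWeight c N (n 2))
    have hi : 0 ≤ ∑ n ∈ (Finset.Nat.antidiagonalTuple 3 N).filter (fun n => ¬ (n 0).Prime) ∩
        (Finset.Nat.antidiagonalTuple 3 N).filter (fun n => ¬ (n 1).Prime),
        vmWeight N (n 0) * vmWeight N (n 1) * hbWeight c N (n 2) :=
      Finset.sum_nonneg fun n _ => hFnn n
    linarith
  -- Step 3: the two filtered sums
  rw [sum_filter_not_prime_one_eq] at hsplit
  have hS0 := sum_filter_not_prime_zero_le' N (f₃ := hbWeight c N) (hbWeight_nonneg c N)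
  -- Step 4: numerics
  have hψ : ψ (N : ℝ) - θ (N : ℝ) ≤ 2 * √(N : ℝ) * Real.log N := Chebyshev.psi_sub_theta_le hN1
  have hM : ∑ m ∈ range (N + 1), hbWeight c N m ≤ 9 * N * Real.log N :=
    (sum_hbWeight_le c N).trans (mass_le hc hN)
  have hM0 : 0 ≤ ∑ m ∈ range (N + 1), hbWeight c N m :=
    Finset.sum_nonneg fun m _ => hbWeight_nonneg c N m
  have hprod : (ψ (N : ℝ) - θ (N : ℝ)) * Real.log N * ∑ m ∈ range (N + 1), hbWeight c N m ≤
      2 * √(N : ℝ) * Real.log N * Real.log N * (9 * N * Real.log N) :=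
    mul_le_mul (mul_le_mul_of_nonneg_right hψ hL0) hM hM0 (by positivity)
  have hsqrt : √(N : ℝ) * N = (N : ℝ) ^ ((3 : ℝ) / 2) := by
    rw [Real.sqrt_eq_rpow, ← Real.rpow_add_one hN0.ne']; norm_num
  have hL4 : Real.log N ^ 3 ≤ Real.log N ^ (4 : ℝ) := by
    rw [show Real.log N ^ (4 : ℝ) = Real.log N ^ (4 : ℕ) by exact_mod_cast Real.rpow_natCast _ 4]
    exact pow_le_pow_right₀ hL1 (by norm_num)
  have hN32 : 0 ≤ (N : ℝ) ^ ((3 : ℝ) / 2) := by positivity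
  calc ternarySum (vmWeight N) (vmWeight N) (hbWeight c N) N
      ≤ 2 * ((ψ (N : ℝ) - θ (N : ℝ)) * Real.log N * ∑ m ∈ range (N + 1), hbWeight c N m) := by
        linarith
    _ ≤ 2 * (2 * √(N : ℝ) * Real.log N * Real.log N * (9 * N * Real.log N)) := by linarith
    _ = 36 * (√(N : ℝ) * N) * Real.log N ^ 3 := by ring
    _ = 36 * (N : ℝ) ^ ((3 : ℝ) / 2) * Real.log N ^ 3 := by rw [hsqrt]
    _ ≤ 36 * (N : ℝ) ^ ((3 : ℝ) / 2) * Real.log N ^ (4 : ℝ) := by gcongr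

end ReadoutProof

end Summit.Parity.GeneralizedHardyLittlewood.Theses.VinogradovHeathBrown

end
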